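import Literature.NumberTheory.GaloisCohomology.LocalInvariantMapSubgroup
import Literature.NumberTheory.GaloisRepresentations.ContinuousCupProductConj
import Literature.NumberTheory.GaloisRepresentations.CorestrictionTransferComparison
import HarnessLib

/-!
# The local pairing on an open subgroup of `Γ_{K_v}`: `⟨a, b⟩_S := inv_S (a ∪ b)` and its projection formula

Let `K` be a number field, `v` a finite place, `n ≥ 1`, `Γ = Γ_{K_v}`, and `⟨ , ⟩ : X × Y → μₙ` a
continuous `Γ`-equivariant pairing of discrete `Γ`-modules (`ContPairing`, e.g. the Weil pairing of
`E[n]` restricted to `Γ_{K_v}`). For a closed subgroup `S ≤ Γ` of finite index (an open subgroup: the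
absolute Galois group of the finite extension `L = K̄_v^S`, kept INSIDE `Γ`), the finite-level local
Tate pairing of `L` in the subgroup dialect is

  `⟨a, b⟩_S := inv_S (a ∪ b) ∈ ℤ/n`,  `a ∈ H¹(S, X)`, `b ∈ H¹(S, Y)`

(`localPairingSubgroup`; `inv_S = inv_v ∘ cor_{Γ/S}` of `LocalInvariantMapSubgroup.lean`, cup product
of `ContinuousCupProduct.lean`). This file proves the **projection formula along `S' ≤ S`**:

  `⟨cor_{S/S'} a', b⟩_S = ⟨a', res_{S/S'} b⟩_{S'}`   (`localPairingSubgroup_coresLe`)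

for `a' ∈ H¹(S', X)`, `b ∈ H¹(S, Y)`, with `cor_{S/S'}` the tree's RELATIVE TRANSFER corestriction
`coresLe` of `ContinuousCorestriction.lean` (the one used by norm-compatible systems along a
`ℤ_p`-tower, `Kato2004.layerCores`) and `res_{S/S'} = resLe`. Proof: `coresLe = cor` (Shapiro) in
degree one (`cores_eq_cor`), the projection formula `cor(res a ∪ b) = a ∪ cor b`
(`cor_cupProduct_resH`) inside the profinite group `↥S`, transitivity of the local invariants
`inv_S ∘ cor_{S/S'} = inv_{S'}` (`localInvariantMapSubgroup_cor`), and naturality of the cup product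
along the tautological comparison `S' ≅ S'.subgroupOf S` (`cupProduct_mapPair`). Also recorded: the
restriction law `⟨res a₀, res b₀⟩_S = (Γ : S) · inv_v(a₀ ∪ b₀)` (`localPairingSubgroup_resH`).

This is the local half of the layer-`n` pairings `H¹(ℚ_n, T) × E(ℚ_{n,v}) → ℤ/p^k` of Perrin-Riou /
Kato §13.8 along the cyclotomic tower (K3 of the BSD cell: the projection formula is hypothesis (P1)
of `SignedKatoOffTwo.ColGlue.exists_col_linear`). Definitions with bodies and theorems; no named fact,
no instance, no `sorry`.

## References
* J. Neukirch, A. Schmidt, K. Wingberg, *Cohomology of Number Fields* (2008), I §5 Prop. 1.5.3 (iv)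
  (projection formula), (7.2.6)/(7.1.4) (local duality and corestriction). [NeukirchSchmidtWingberg2008]
* J.-P. Serre, *Local Fields* (1979), XI §2 Prop. 1 (ii), XIII §3 Prop. 7. [SerreLocalFields1979]
* B. Perrin-Riou, *Théorie d'Iwasawa des représentations p-adiques sur un corps local* (1994), §3.6.1.
  [PerrinRiou1994Invent]
-/

noncomputable section

open CategoryTheory Function NumberField IsDedekindDomain

universe u

namespace Literature.NumberTheory.GaloisCohomology

open Literature.NumberTheory.GaloisRepresentations
open Literature.NumberTheory.GaloisRepresentations.DiscreteGaloisModule (mu MuCarrier)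
open _root_.TopRep _root_.ContinuousCohomology

attribute [local instance] absoluteGaloisGroup_compactSpace compactSpace_of_isClosed_subgroup
  isClosed_subgroupOf_of_isClosed

variable (K : Type) [Field K] [NumberField K] (n : ℕ) [NeZero n] (v : HeightOneSpectrum (𝓞 K))
variable {MX MY : Type} [AddCommGroup MX] [TopologicalSpace MX] [DiscreteTopology MX]
  [AddCommGroup MY] [TopologicalSpace MY] [DiscreteTopology MY]
variable (ρX : ContinuousRep (Field.absoluteGaloisGroup (v.adicCompletion K)) ℤ MX)
  (ρY : ContinuousRep (Field.absoluteGaloisGroup (v.adicCompletion K)) ℤ MY)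
  (P : ContPairing ρX.toTopRep ρY.toTopRep (muAt K n v).toTopRep)
variable (S : Subgroup (Field.absoluteGaloisGroup (v.adicCompletion K)))
  [hS : IsClosed (S : Set (Field.absoluteGaloisGroup (v.adicCompletion K)))]
  [Fintype (Field.absoluteGaloisGroup (v.adicCompletion K) ⧸ S)]

/-! ### The pairing `⟨a, b⟩_S = inv_S (a ∪ b)` -/

/-- **The local pairing on the open subgroup `S ≤ Γ_{K_v}`**: `⟨a, b⟩_S := inv_S (a ∪ b) ∈ ℤ/n` for
`a ∈ H¹(S, X)`, `b ∈ H¹(S, Y)` and a pairing `X × Y → μₙ` (cup product on `S` for the restricted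
pairing `resPairing`, then the invariant map of `S`), bi-additive. For `X = Y = E[n]` with
the Weil pairing this is the level-`n` local Tate pairing of the field `K̄_v^S`.
[cite: NeukirchSchmidtWingberg2008, I §5 Prop. 1.5.3 (iv)] -/
def localPairingSubgroup :
    (continuousCohomology 1 (ρX.restrict (subgroupIncl S)).toTopRep : Type) →+
      (continuousCohomology 1 (ρY.restrict (subgroupIncl S)).toTopRep : Type) →+ ZMod n :=
  AddMonoidHom.mk'
    (fun a => AddMonoidHom.mk'
      (fun b => localInvariantMapSubgroup K n v S ((resPairing S ρX ρY (muAt K n v) P).cupProduct a b))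
      (fun b b' => by simp only [map_add]))
    (fun a a' => by
      ext b
      simp only [AddMonoidHom.mk'_apply, AddMonoidHom.add_apply, map_add, LinearMap.add_apply])

/-- Unfolding: `⟨a, b⟩_S = inv_S (a ∪ b)`. [cite: NeukirchSchmidtWingberg2008, I §5 Prop. 1.5.3 (iv)] -/
theorem localPairingSubgroup_apply (a : continuousCohomology 1 (ρX.restrict (subgroupIncl S)).toTopRep)
    (b : continuousCohomology 1 (ρY.restrict (subgroupIncl S)).toTopRep) :
    localPairingSubgroup K n v ρX ρY P S a b =
      localInvariantMapSubgroup K n v S ((resPairing S ρX ρY (muAt K n v) P).cupProduct a b) := rfl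

/-- **Restriction law** `⟨res a₀, res b₀⟩_S = (Γ : S) · inv_v (a₀ ∪ b₀)` (`cupProduct_res`,
`localInvariantMapSubgroup_resH`; Serre XIII §3 Prop. 7). [cite: SerreLocalFields1979, XIII §3 Prop. 7] -/
theorem localPairingSubgroup_resH (a₀ : continuousCohomology 1 ρX.toTopRep)
    (b₀ : continuousCohomology 1 ρY.toTopRep) :
    localPairingSubgroup K n v ρX ρY P S (resH S ρX 1 a₀) (resH S ρY 1 b₀) =
      S.index • localInvariantMap K n v (P.cupProduct a₀ b₀) := by
  rw [localPairingSubgroup_apply, ← localInvariantMapSubgroup_resH]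
  exact congrArg (localInvariantMapSubgroup K n v S)
    (ContPairing.cupProduct_res P (subgroupIncl S) a₀ b₀).symm

/-! ### Conjugation invariance -/

/-- **`⟨g · a, g · b⟩_S = ⟨a, b⟩_S`** for `S` closed normal of finite index and `g ∈ Γ_{K_v}`: the cup
product commutes with the conjugation action (`cupProduct_conjMap`) and `inv_S` is conjugation
invariant (`localInvariantMapSubgroup_conjMap`). (Galois invariance of the finite-level local Tate
pairing of the Galois extension `K̄_v^S / K_v`.) [cite: NeukirchSchmidtWingberg2008, I §5 Prop. 1.5.3] -/
theorem localPairingSubgroup_conjMap [S.Normal] (g : Field.absoluteGaloisGroup (v.adicCompletion K))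
    (a : continuousCohomology 1 (ρX.restrict (subgroupIncl S)).toTopRep)
    (b : continuousCohomology 1 (ρY.restrict (subgroupIncl S)).toTopRep) :
    localPairingSubgroup K n v ρX ρY P S (conjMap ρX.toTopRep S g 1 a) (conjMap ρY.toTopRep S g 1 b) =
      localPairingSubgroup K n v ρX ρY P S a b := by
  haveI : LocallyCompactSpace S := inferInstance
  rw [localPairingSubgroup_apply, localPairingSubgroup_apply]
  -- `resPairing S … P` is `P.restrict (subgroupIncl S)` (same fields), so `cupProduct_conjMap` applies
  have hc : (resPairing S ρX ρY (muAt K n v) P).cupProduct (conjMap ρX.toTopRep S g 1 a)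
        (conjMap ρY.toTopRep S g 1 b) =
      conjMap (muAt K n v).toTopRep S g 2 ((resPairing S ρX ρY (muAt K n v) P).cupProduct a b) :=
    (ContPairing.cupProduct_conjMap P S g a b).symm
  rw [hc]
  exact localInvariantMapSubgroup_conjMap K n v S g _

/-! ### The projection formula `⟨cor_{S/S'} a', b⟩_S = ⟨a', res_{S/S'} b⟩_{S'}` -/

section Projection

variable (S' : Subgroup (Field.absoluteGaloisGroup (v.adicCompletion K)))
  [hS' : IsClosed (S' : Set (Field.absoluteGaloisGroup (v.adicCompletion K)))]
  [Fintype (Field.absoluteGaloisGroup (v.adicCompletion K) ⧸ S')] [Fintype (S ⧸ S'.subgroupOf S)]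

omit [NeZero n] [Fintype (Field.absoluteGaloisGroup (v.adicCompletion K) ⧸ S)]
  [Fintype (Field.absoluteGaloisGroup (v.adicCompletion K) ⧸ S')] in
/-- Step 1: the relative transfer corestriction `coresLe` is the Shapiro corestriction of the
profinite group `↥S` along `S'.subgroupOf S`, in degree one (`cores_eq_cor`).
[cite: SerreGaloisCohomology1997, I §2.5] -/
theorem coresLe_eq_cor (h : S' ≤ S)
    (hS'o : IsOpen (S' : Set (Field.absoluteGaloisGroup (v.adicCompletion K))))
    (a' : continuousCohomology 1 (ρX.restrict (subgroupIncl S')).toTopRep) :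
    coresLe ρX.toTopRep h hS'o a' =
      cor (S'.subgroupOf S) (ρX.restrict (subgroupIncl S)) 1 (toSubgroupOf ρX.toTopRep h 1 a') := by
  rw [coresLe, LinearMap.coe_comp, Function.comp_apply]
  exact cores_eq_cor (S'.subgroupOf S) (ρX.restrict (subgroupIncl S)) (isOpen_subgroupOf S hS'o) _

omit [NeZero n] [Fintype (Field.absoluteGaloisGroup (v.adicCompletion K) ⧸ S)]
  [Fintype (Field.absoluteGaloisGroup (v.adicCompletion K) ⧸ S')] in
/-- Step 2: the projection formula inside `↥S` with the corestriction in the FIRST slot: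
`(cor_{S/S'} a'') ∪ b = cor_{S/S'} (a'' ∪ res b)` (from the tree's `cor_cupProduct_resH`, which has
the corestriction in the second slot, by graded commutativity `cupProduct_comm` twice).
[cite: NeukirchSchmidtWingberg2008, I §5 Prop. 1.5.3 (iv)] -/
theorem cupProduct_cor_left (a'' : continuousCohomology 1 (repSub S S' ρX).toTopRep)
    (b : continuousCohomology 1 (ρY.restrict (subgroupIncl S)).toTopRep) :
    (resPairing S ρX ρY (muAt K n v) P).cupProduct
        (cor (S'.subgroupOf S) (ρX.restrict (subgroupIncl S)) 1 a'') b =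
      cor (S'.subgroupOf S) ((muAt K n v).restrict (subgroupIncl S)) 2
        ((resPairing (S'.subgroupOf S) (ρX.restrict (subgroupIncl S)) (ρY.restrict (subgroupIncl S))
            ((muAt K n v).restrict (subgroupIncl S)) (resPairing S ρX ρY (muAt K n v) P)).cupProduct a''
          (resH (S'.subgroupOf S) (ρY.restrict (subgroupIncl S)) 1 b)) := by
  haveI : LocallyCompactSpace S := inferInstance
  haveI : LocallyCompactSpace (S'.subgroupOf S : Subgroup S) := inferInstance
  have h1 := cor_cupProduct_resH (S'.subgroupOf S) (ρY.restrict (subgroupIncl S))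
    (ρX.restrict (subgroupIncl S)) ((muAt K n v).restrict (subgroupIncl S))
    (resPairing S ρX ρY (muAt K n v) P).flip b a''
  have h2 : -((resPairing (S'.subgroupOf S) (ρY.restrict (subgroupIncl S)) (ρX.restrict (subgroupIncl S))
            ((muAt K n v).restrict (subgroupIncl S)) (resPairing S ρX ρY (muAt K n v) P).flip).cupProduct
              (resH (S'.subgroupOf S) (ρY.restrict (subgroupIncl S)) 1 b) a'') =
      (resPairing (S'.subgroupOf S) (ρX.restrict (subgroupIncl S)) (ρY.restrict (subgroupIncl S))
            ((muAt K n v).restrict (subgroupIncl S)) (resPairing S ρX ρY (muAt K n v) P)).cupProduct a''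
          (resH (S'.subgroupOf S) (ρY.restrict (subgroupIncl S)) 1 b) := by
    rw [ContPairing.cupProduct_comm (resPairing (S'.subgroupOf S) (ρX.restrict (subgroupIncl S))
      (ρY.restrict (subgroupIncl S)) ((muAt K n v).restrict (subgroupIncl S))
      (resPairing S ρX ρY (muAt K n v) P)) a'']
    rfl
  calc (resPairing S ρX ρY (muAt K n v) P).cupProduct
          (cor (S'.subgroupOf S) (ρX.restrict (subgroupIncl S)) 1 a'') b
      = -((resPairing S ρX ρY (muAt K n v) P).flip.cupProduct b
          (cor (S'.subgroupOf S) (ρX.restrict (subgroupIncl S)) 1 a'')) :=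
        ContPairing.cupProduct_comm _ _ _
    _ = -(cor (S'.subgroupOf S) ((muAt K n v).restrict (subgroupIncl S)) 2
          ((resPairing (S'.subgroupOf S) (ρY.restrict (subgroupIncl S)) (ρX.restrict (subgroupIncl S))
            ((muAt K n v).restrict (subgroupIncl S)) (resPairing S ρX ρY (muAt K n v) P).flip).cupProduct
              (resH (S'.subgroupOf S) (ρY.restrict (subgroupIncl S)) 1 b) a'')) :=
        congrArg Neg.neg h1.symm
    _ = cor (S'.subgroupOf S) ((muAt K n v).restrict (subgroupIncl S)) 2
          (-((resPairing (S'.subgroupOf S) (ρY.restrict (subgroupIncl S)) (ρX.restrict (subgroupIncl S))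
            ((muAt K n v).restrict (subgroupIncl S)) (resPairing S ρX ρY (muAt K n v) P).flip).cupProduct
              (resH (S'.subgroupOf S) (ρY.restrict (subgroupIncl S)) 1 b) a'')) := (map_neg _ _).symm
    _ = _ := congrArg (fun t => cor (S'.subgroupOf S) ((muAt K n v).restrict (subgroupIncl S)) 2 t) h2

omit [NeZero n] [Fintype (Field.absoluteGaloisGroup (v.adicCompletion K) ⧸ S)]
  [Fintype (Field.absoluteGaloisGroup (v.adicCompletion K) ⧸ S')] [Fintype (S ⧸ S'.subgroupOf S)] in
/-- Step 3: the tautological comparison `S' ≅ S'.subgroupOf S` commutes with cup products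
(`cupProduct_mapPair` with identity coefficient maps). [cite: NeukirchSchmidtWingberg2008, I §5 Prop. 1.5.3] -/
theorem ofSubgroupOf_cupProduct (h : S' ≤ S) (a'' : continuousCohomology 1 (repSub S S' ρX).toTopRep)
    (c : continuousCohomology 1 (repSub S S' ρY).toTopRep) :
    ofSubgroupOf S S' (muAt K n v) h 2
        ((resPairing (S'.subgroupOf S) (ρX.restrict (subgroupIncl S)) (ρY.restrict (subgroupIncl S))
            ((muAt K n v).restrict (subgroupIncl S)) (resPairing S ρX ρY (muAt K n v) P)).cupProduct a'' c) =
      (resPairing S' ρX ρY (muAt K n v) P).cupProduct (ofSubgroupOf S S' ρX h 1 a'')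
        (ofSubgroupOf S S' ρY h 1 c) := by
  haveI : LocallyCompactSpace S' := inferInstance
  haveI : LocallyCompactSpace (S'.subgroupOf S : Subgroup S) := inferInstance
  exact ContPairing.cupProduct_mapPair
    (resPairing (S'.subgroupOf S) (ρX.restrict (subgroupIncl S)) (ρY.restrict (subgroupIncl S))
      ((muAt K n v).restrict (subgroupIncl S)) (resPairing S ρX ρY (muAt K n v) P))
    (resPairing S' ρX ρY (muAt K n v) P) (toSubgroupOfHom S S' h)
    (TopRep.ofHom ⟨ContinuousLinearMap.id ℤ MX, fun _ => rfl⟩)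
    (TopRep.ofHom ⟨ContinuousLinearMap.id ℤ MY, fun _ => rfl⟩)
    (TopRep.ofHom ⟨ContinuousLinearMap.id ℤ (MuCarrier K n), fun _ => rfl⟩) (fun _ _ => rfl) a'' c

omit hS hS' [Fintype (Field.absoluteGaloisGroup (v.adicCompletion K) ⧸ S)]
  [Fintype (Field.absoluteGaloisGroup (v.adicCompletion K) ⧸ S')] [Fintype (S ⧸ S'.subgroupOf S)] [NeZero n] in
/-- Step 4: `ofSubgroupOf ∘ toSubgroupOf = id` on `H^q(S', X)`. [cite: SerreGaloisCohomology1997, I §2.4] -/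
theorem ofSubgroupOf_toSubgroupOf (h : S' ≤ S) (q : ℕ)
    (a' : continuousCohomology q (ρX.restrict (subgroupIncl S')).toTopRep) :
    ofSubgroupOf S S' ρX h q (toSubgroupOf ρX.toTopRep h q a') = a' := by
  refine (map_comp_apply_of (subgroupOfHom h) (toSubgroupOfHom S S' h) (ContinuousMonoidHom.id S')
    (fun _ => rfl) _ _
    (TopRep.ofHom ⟨ContinuousLinearMap.id ℤ MX, fun _ => rfl⟩ :
      TopRep.res ((ContinuousMonoidHom.id S' : S' →ₜ* S') : S' →* S')
        (ρX.restrict (subgroupIncl S')).toTopRep ⟶ (ρX.restrict (subgroupIncl S')).toTopRep)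
    (fun _ => rfl) q a').symm.trans ?_
  exact map_apply_of_id (ContinuousMonoidHom.id S') (fun _ => rfl) _ (fun _ => rfl) q a'

omit hS hS' [Fintype (Field.absoluteGaloisGroup (v.adicCompletion K) ⧸ S)]
  [Fintype (Field.absoluteGaloisGroup (v.adicCompletion K) ⧸ S')] [Fintype (S ⧸ S'.subgroupOf S)] [NeZero n] in
/-- Step 5: `ofSubgroupOf ∘ res_{S/S'.subgroupOf S}` is the restriction `H^q(S, Y) → H^q(S', Y)` along
`S' ≤ S` (the tree's `resLe`, written here on the `restrict` side). [cite: SerreGaloisCohomology1997, I §2.4] -/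
theorem ofSubgroupOf_resH (h : S' ≤ S) (q : ℕ)
    (b : continuousCohomology q (ρY.restrict (subgroupIncl S)).toTopRep) :
    ofSubgroupOf S S' ρY h q (resH (S'.subgroupOf S) (ρY.restrict (subgroupIncl S)) q b) =
      ContinuousCohomology.map (Literature.NumberTheory.EllipticCurves.subgroupInclusion h)
        (TopRep.ofHom ⟨ContinuousLinearMap.id ℤ MY, fun _ => rfl⟩ :
          TopRep.res ((Literature.NumberTheory.EllipticCurves.subgroupInclusion h : S' →ₜ* S) : S' →* S)
            (ρY.restrict (subgroupIncl S)).toTopRep ⟶ (ρY.restrict (subgroupIncl S')).toTopRep) q b :=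
  (map_comp_apply_of (subgroupIncl (S'.subgroupOf S : Subgroup S)) (toSubgroupOfHom S S' h)
    (Literature.NumberTheory.EllipticCurves.subgroupInclusion h) (fun _ => rfl) _ _ _
    (fun _ => rfl) q b).symm

omit hS hS' [Fintype (Field.absoluteGaloisGroup (v.adicCompletion K) ⧸ S)]
  [Fintype (Field.absoluteGaloisGroup (v.adicCompletion K) ⧸ S')] [Fintype (S ⧸ S'.subgroupOf S)] [NeZero n] in
/-- The restriction `H^q(S, Y) → H^q(S', Y)` on the `restrict` side IS the tree's `resLe` (same
compatible pair; definitional). [cite: SerreGaloisCohomology1997, I §2.4] -/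
theorem map_subgroupInclusion_eq_resLe (h : S' ≤ S) (q : ℕ)
    (b : continuousCohomology q (ρY.restrict (subgroupIncl S)).toTopRep) :
    ContinuousCohomology.map (Literature.NumberTheory.EllipticCurves.subgroupInclusion h)
        (TopRep.ofHom ⟨ContinuousLinearMap.id ℤ MY, fun _ => rfl⟩ :
          TopRep.res ((Literature.NumberTheory.EllipticCurves.subgroupInclusion h : S' →ₜ* S) : S' →* S)
            (ρY.restrict (subgroupIncl S)).toTopRep ⟶ (ρY.restrict (subgroupIncl S')).toTopRep) q b =
      resLe ρY.toTopRep h q b := rfl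

/-- **The projection formula `⟨cor_{S/S'} a', b⟩_S = ⟨a', res_{S/S'} b⟩_{S'}`** for closed
finite-index `S' ≤ S ≤ Γ_{K_v}` (`S'` open), `a' ∈ H¹(S', X)`, `b ∈ H¹(S, Y)`: with the tree's
relative transfer corestriction `coresLe` on the left and restriction `resLe` on the right — the
finite-level form of `⟨Cor_{L'/L} x, y⟩_L = ⟨x, Res_{L'/L} y⟩_{L'}` for the local Tate pairings of
`L' = K̄_v^{S'} ⊇ L = K̄_v^S`. [cite: NeukirchSchmidtWingberg2008, I §5 Prop. 1.5.3 (iv)] -/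
theorem localPairingSubgroup_coresLe (h : S' ≤ S)
    (hS'o : IsOpen (S' : Set (Field.absoluteGaloisGroup (v.adicCompletion K))))
    (a' : continuousCohomology 1 (ρX.restrict (subgroupIncl S')).toTopRep)
    (b : continuousCohomology 1 (ρY.restrict (subgroupIncl S)).toTopRep) :
    localPairingSubgroup K n v ρX ρY P S (coresLe ρX.toTopRep h hS'o a') b =
      localPairingSubgroup K n v ρX ρY P S' a' (resLe ρY.toTopRep h 1 b) := by
  rw [localPairingSubgroup_apply, localPairingSubgroup_apply, coresLe_eq_cor K v ρX S S' h hS'o a',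
    cupProduct_cor_left K n v ρX ρY P S S' (toSubgroupOf ρX.toTopRep h 1 a') b,
    localInvariantMapSubgroup_cor K n v S S' h, ofSubgroupOf_cupProduct K n v ρX ρY P S S' h,
    ofSubgroupOf_toSubgroupOf K v ρX S S' h 1 a', ofSubgroupOf_resH K v ρY S S' h 1 b,
    map_subgroupInclusion_eq_resLe K v ρY S S' h 1 b]

end Projection

end Literature.NumberTheory.GaloisCohomology
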